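import Summits.AtomisticToContinuum.HydrodynamicLimit.Theorems.AntiMazurCoboundariesCellForecastPressureDecayEnskogObjects
import Literature.Analysis.FluidPDE.HardSphereCollisionRecord
import HarnessLib

/-!
# S2d · kinematic assembly, piece 1: a non-participating sphere flies freely
# (registered sub-goal `stub_kinematicAssembly_noCollision` of stub `stub_kinematicAssembly`, crux line
# `enskog-compensator-martingale`, crux `CellForecastPressureDecay`, stmt-AtomisticToContinuum-13915)

The equal-time Enskog kinematics of the cell law (`KinematicRates σ`, stub S2d) telescopes the increment
`w(vᵢ(Δ)) − w(vᵢ(0))` of every sphere over ITS collisions in the slab `[0, Δ]`: velocities of a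
hard-sphere trajectory only change at the collisions in which the sphere takes part. This file proves the
deterministic fact behind it, for a hard-sphere trajectory `γ` (`IsHardSphereTrajectory`) in ANY geometry
with continuous translations over a Hausdorff position space (`ℝ³` and `𝕋³`):

* `apply_eq_of_not_participates` — at a collision time at which `j` does not participate, the state of
  `j` is that of the left limit (the elastic jump `collidePair` only touches the colliding pair);
* `apply_eq_freeFlight_of_forall_not_participates` — **if `j` takes part in no collision at the times of
  `(a, b]`, then `γ b j` is the free flight of `γ a j`**: `x_j(b) = x_j(a) + (b − a) v_j(a)`,
  `v_j(b) = v_j(a)` (a locally-constant argument on the pulled-back state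
  `t ↦ (x_j(t) − t v_j(t), v_j(t))`, free flight between the collisions of the others);
* `stub_kinematicAssembly_noCollision` — the registered form for the whole-cell Euclidean flow
  `(Ψ n).flow` of the line's objects on its good set.

References: Gallagher–Saint-Raymond–Texier 2013, §4.1 (Def. 4.1.2: free flow between collisions, elastic
reflection of the colliding pair only); Cercignani–Illner–Pulvirenti 1994 §4.2.
-/

noncomputable section

open MeasureTheory ProbabilityTheory Set Filter Topology
open scoped ENNReal BigOperators InnerProductSpace
open Literature.Analysis.FluidPDE Literature.MathematicalPhysics.KineticTheory

namespace Summit.AtomisticToContinuum.HydrodynamicLimit.Theorems.EnskogCompensator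

/-! ## Trajectory level, any geometry -/

section Trajectory

variable {d : Type*} [Fintype d] {X : Type*} [TopologicalSpace X] [T2Space X] {N : ℕ}
  {G : Geometry d X} {ε : ℝ} {γ : ℝ → Config N d X}

/-- At a collision time at which `j` does not participate, the state of `j` is that of the left limit:
the elastic jump only changes the colliding pair. [cite: GST2013, §4.1 Def. 4.1.2] -/
theorem apply_eq_of_not_participates (h : IsHardSphereTrajectory G ε N γ) {t : ℝ}
    (ht : t ∈ collisionTimes G ε γ) {j : Fin N} (hj : ¬ Participates G ε (γ t) j)
    {zl : Config N d X} (hzl : Tendsto γ (𝓝[<] t) (𝓝 zl)) : γ t j = zl j := by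
  obtain ⟨p, q, hpq, hc⟩ := ht
  obtain ⟨-, zl', hzl', -, heq⟩ := h.binary t p q hpq hc
  have hzz : zl' = zl := tendsto_nhds_unique hzl' hzl
  subst hzz
  have hpc : (p, q) ∈ contactPairs G ε (γ t) := mem_contactPairs.2 ⟨hpq, hc⟩
  have hjp : j ≠ p := fun hjp => hj ⟨q, Or.inl (hjp ▸ hpc)⟩
  have hjq : j ≠ q := fun hjq => hj ⟨p, Or.inr (hjq ▸ hpc)⟩
  rw [heq, collidePair_apply_of_ne hjp hjq]

/-- For `y < t` with `(y, t)` collision-free and `j` not participating at `t` (if `t` is a collision time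
at all), the state of `j` at `t` is the free flight of its state at `y`. [cite: GST2013, §4.1 Def. 4.1.2] -/
theorem apply_eq_freeFlight_of_Ioo_free_of_not_participates (h : IsHardSphereTrajectory G ε N γ)
    (hG : ∀ x : X, Continuous (G.translate x)) {y t : ℝ} (hyt : y < t)
    (hfree : ∀ s ∈ Ioo y t, s ∉ collisionTimes G ε γ) {j : Fin N}
    (hj : t ∈ collisionTimes G ε γ → ¬ Participates G ε (γ t) j) :
    γ t j = freeFlight G (t - y) (γ y) j := by
  by_cases htc : t ∈ collisionTimes G ε γ
  · exact apply_eq_of_not_participates h htc (hj htc) (h.tendsto_nhdsLT hG hyt hfree)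
  · rw [h.free y t hyt.le fun s hs => ?_]
    rcases hs.2.eq_or_lt with rfl | hlt
    · exact htc
    · exact hfree s ⟨hs.1, hlt⟩

omit [TopologicalSpace X] [T2Space X] in
/-- Pulling a freely flown state back to time `0` gives the pulled-back initial state. [folklore] -/
theorem translate_freeFlight_neg (x : X) (v : EuclideanSpace ℝ d) (s t : ℝ) :
    G.translate (G.translate x ((t - s) • v)) (-t • v) = G.translate x (-s • v) := by
  rw [G.translate_add, ← add_smul]
  congr 1
  ring_nf

/-- **A non-participating sphere flies freely.** On a hard-sphere trajectory in a geometry with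
continuous translations, if sphere `j` takes part in no collision at the times of `(a, b]`, then its state
at time `b` is the free flight of its state at time `a`: `x_j(b) = x_j(a) + (b − a) v_j(a)`, `v_j(b) = v_j(a)`.
[cite: GST2013, §4.1 Def. 4.1.2] -/
theorem apply_eq_freeFlight_of_forall_not_participates (h : IsHardSphereTrajectory G ε N γ)
    (hG : ∀ x : X, Continuous (G.translate x)) {a b : ℝ} (hab : a ≤ b) {j : Fin N}
    (hnp : ∀ t ∈ Ioc a b, ¬ Participates G ε (γ t) j) :
    γ b j = (G.translate (γ a j).1 ((b - a) • (γ a j).2), (γ a j).2) := by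
  -- the pulled-back state of `j`, read through the clamp `t ↦ max a (min t b)`, is locally constant on `ℝ`
  set c : ℝ → ℝ := fun t => max a (min t b) with hc
  set f : ℝ → X × EuclideanSpace ℝ d := fun t =>
    (G.translate (γ (c t) j).1 (-(c t) • (γ (c t) j).2), (γ (c t) j).2) with hf
  have hca : c a = a := by simp [hc, hab]
  have hcb : c b = b := by simp [hc, hab]
  -- the pull-back is invariant under free flight
  have key : ∀ {y t : ℝ}, γ t j = freeFlight G (t - y) (γ y) j →
      (G.translate (γ t j).1 (-t • (γ t j).2), (γ t j).2) =
        (G.translate (γ y j).1 (-y • (γ y j).2), (γ y j).2) := by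
    intro y t hyt
    rw [hyt, freeFlight_apply, translate_freeFlight_neg]
  have hloc : IsLocallyConstant f := by
    refine (IsLocallyConstant.iff_eventually_eq _).2 fun t => ?_
    rcases lt_or_ge t a with hta | hta
    · filter_upwards [eventually_lt_nhds hta] with y hy
      simp only [hf, hc, max_eq_left (min_le_of_left_le hy.le), max_eq_left (min_le_of_left_le hta.le)]
    rcases lt_or_ge b t with hbt | htb
    · filter_upwards [eventually_gt_nhds hbt] with y hy
      simp only [hf, hc, min_eq_right hy.le, min_eq_right hbt.le]
    -- `a ≤ t ≤ b`: use the free stretches on both sides of `t`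
    have hct : c t = t := by simp [hc, hta, htb]
    obtain ⟨s₀, hs₀t, hfreel⟩ := h.exists_Ioo_left_free t
    obtain ⟨u₀, htu₀, hfreer⟩ := h.exists_Ioo_right_free t
    -- to the right of `t` (inside `[t, u₀)`) the trajectory is the free flight from `γ t`
    have hright : ∀ y, t ≤ y → y < u₀ → f y = f t := by
      intro y hty hyu
      have hcy : c y ∈ Ico t u₀ := by
        refine ⟨le_max_of_le_right (le_min hty htb), ?_⟩
        exact max_lt (lt_of_le_of_lt hta htu₀) (lt_of_le_of_lt (min_le_left _ _) hyu)
      have hflight : γ (c y) j = freeFlight G (c y - t) (γ t) j := by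
        rw [h.eq_freeFlight_of_Ioo_free hfreer hcy]
      simp only [hf]
      rw [key hflight, hct]
    rcases hta.eq_or_lt with rfl | hat
    · -- `t = a`: to the left of `a` the clamp is constant
      filter_upwards [Ioo_mem_nhds (show a - 1 < a by linarith) htu₀] with y hy
      rcases lt_or_ge y a with hya | hay
      · simp only [hf, hc, max_eq_left (min_le_of_left_le hya.le), min_eq_left hab, max_self]
      · exact hright y hay hy.2
    · -- `a < t ≤ b`: to the left, free flight on `(y, t)` and no jump of `j` at `t`
      have hm : max s₀ a < t := max_lt hs₀t hat
      filter_upwards [Ioo_mem_nhds hm htu₀] with y hy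
      rcases lt_or_ge y t with hyt | hty
      · have hay : a ≤ y := (le_max_right _ _).trans hy.1.le
        have hcy : c y = y := by simp [hc, hay, (hyt.le.trans htb)]
        have hsy : s₀ < y := (le_max_left _ _).trans_lt hy.1
        have hfree' : ∀ s ∈ Ioo y t, s ∉ collisionTimes G ε γ := fun s hs =>
          hfreel s ⟨hsy.trans hs.1, hs.2⟩
        have hflight : γ t j = freeFlight G (t - y) (γ y) j :=
          apply_eq_freeFlight_of_Ioo_free_of_not_participates h hG hyt hfree' fun _ => hnp t ⟨hat, htb⟩
        simp only [hf, hcy, hct]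
        exact (key hflight).symm
      · exact hright y hty hy.2
  have hfba : f b = f a := hloc.apply_eq_of_preconnectedSpace b a
  simp only [hf, hca, hcb, Prod.mk.injEq] at hfba
  obtain ⟨hx, hv⟩ := hfba
  -- undo the pull-back
  have hx' := congrArg (fun x => G.translate x (b • (γ b j).2)) hx
  simp only [G.translate_add, neg_smul, neg_add_cancel, G.translate_zero] at hx'
  rw [hv] at hx'
  rw [← sub_eq_neg_add, ← sub_smul] at hx'
  exact Prod.ext hx' hv

/-- Velocity form: a sphere that takes part in no collision at the times of `(a, b]` keeps its velocity.
[cite: GST2013, §4.1 Def. 4.1.2] -/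
theorem vel_eq_of_forall_not_participates (h : IsHardSphereTrajectory G ε N γ)
    (hG : ∀ x : X, Continuous (G.translate x)) {a b : ℝ} (hab : a ≤ b) {j : Fin N}
    (hnp : ∀ t ∈ Ioc a b, ¬ Participates G ε (γ t) j) : (γ b j).2 = (γ a j).2 := by
  rw [apply_eq_freeFlight_of_forall_not_participates h hG hab hnp]

end Trajectory

/-! ## The registered sub-goal: the whole-cell Euclidean flow of the line -/

/-- Translations of `ℝ³` are continuous. [folklore] -/
theorem continuous_euclidean_translate (x : V3) :
    Continuous ((Euclidean.geometry (Fin 3)).translate x) := by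
  change Continuous fun v : V3 => x + v
  fun_prop

/-- **Registered sub-goal `stub_kinematicAssembly_noCollision`** (piece of stub `stub_kinematicAssembly`,
S2d, of the line `enskog-compensator-martingale`): along the whole-cell hard-sphere flow `(Ψ n).flow` of a
good initial datum `z`, a sphere `i` that takes part in no collision at the times of `(a, b]` flies
freely: `xᵢ(b) = xᵢ(a) + (b − a) vᵢ(a)` and `vᵢ(b) = vᵢ(a)`. In particular `w(vᵢ(Δ)) − w(vᵢ(0)) = 0`
for every sphere without a collision in the slab `[0, Δ]`. [cite: GST2013, §4.1 Def. 4.1.2] -/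
theorem stub_kinematicAssembly_noCollision : ∀ (σ : ℝ) (n : ℕ) (Ψ : Flows σ) (z : Cell n), z ∈ (Ψ n).good →
    ∀ (i : Fin n) (a b : ℝ), a ≤ b →
      (∀ t ∈ Set.Ioc a b, ¬ Participates (Euclidean.geometry (Fin 3)) σ ((Ψ n).flow t z) i) →
        ((Ψ n).flow b z i).1 = ((Ψ n).flow a z i).1 + (b - a) • ((Ψ n).flow a z i).2 ∧
          ((Ψ n).flow b z i).2 = ((Ψ n).flow a z i).2 := by
  intro σ n Ψ z hz i a b hab hnp
  have h := apply_eq_freeFlight_of_forall_not_participates ((Ψ n).isTrajectory z hz)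
    continuous_euclidean_translate hab hnp
  rw [h]
  exact ⟨rfl, rfl⟩

end Summit.AtomisticToContinuum.HydrodynamicLimit.Theorems.EnskogCompensator

end
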